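import Summits.QuantumAdvantage.QuantumAdvantage.Theses.CubicForrelation
import Literature.Computability.QuantumComplexity.SignedForrelationMem

/-!
# `SignedExactSliceIsLift` (stmt-QuantumAdvantage-14830), negative side —
# the landed signed family is UNGAPPED on a cubic well-formed code

Negative-side (cdisprove) lemmas for the crux
`Summit.QuantumAdvantage.QuantumAdvantage.Theses.CubicForrelation.SignedExactSliceIsLift`
(K2: `NearExactIsExact → slice ∈ promiseLift BQP`) and for the picked line `reduce-then-lift`
(Cruxes/SignedExactSliceIsLift/PICKED.md: stubs C = total Möbius canonicaliser, V = value set of the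
LANDED family `PhaseQuery.family SgnForrMem.paramsS`, A = exact AND-power amplification).

**What is proved.** On the two-bit instance `(n, k, C₀, C₁) = (2, 2, x₀ ∧ x₁, x₀ ∧ ¬x₁)` — `B₂`-circuits,
`k = 2`, `n` even, both functions of degree `≤ 2 ≤ 3`, every input wire read, and `Φ = 0` — the landed
signed Hadamard-test family accepts with probability EXACTLY `37/64 ∈ (1/3, 2/3)`
(`exists_wf_cubic_code_ungapped`). Consequences:

* `landedFamily_not_bqp_decider`: the landed family decides NO language in the `BQP` sense (it has an
  input with acceptance strictly inside `(1/3, 2/3)`), so K2's separating language can never be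
  witnessed by this family as it stands — amplification (stub A) or a different family is
  load-bearing in any proof of K2 along the picked line;
* `not_noSide_le_third`: the `K = 1` shortcut of stub V — "the landed family already rejects every
  well-formed cubic code with `Φ ≠ 1` with probability `≤ 1/3`" — is FALSE (the witness code is
  well-formed, cubic, even `n`, all wires read, `Φ = 0 ≠ 1`, acceptance `37/64 > 1/3`), with NO appeal to
  `NearExactIsExact`: isolation bounds such acceptances away from `1` only, never below `1/3`.

Helper (positive, Literature-level, reusable by the line's stub V): `norm_phiFin_of_le` — the return
amplitude has modulus EXACTLY `(1 + Φ(I))/2` whenever `k = 2`, `n` is even and `n ≤ #R + 1` (the landed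
`SgnForrMem.norm_phiFin_of_promise` exposes only `∃ ρ ∈ [7/10, 1]` and assumes `|Φ| ≥ 3/5`), and
`acceptProbOn_of_le` — the acceptance is then EXACTLY `1 − (1 − ((1+Φ)/2)²)³`.

No new definitions: the witness circuit `x₀ ∧ ¬x₁` is an inline term (`ungapped_of` abstracts over it).
-/

noncomputable section

set_option linter.dupNamespace false -- D-0017: single-problem summit ⇒ `QuantumAdvantage.QuantumAdvantage` by design

open Literature.Computability.Complexity Literature.Computability.Cryptography
open Literature.Computability.QuantumComplexity
open Literature.Computability.QuantumComplexity.PhaseQuery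
open Literature.Computability.QuantumComplexity.ForrMem
open Literature.Computability.QuantumComplexity.SgnForrMem

namespace Summit.QuantumAdvantage.QuantumAdvantage.Theorems.SignedExactSliceIsLift.Negative

/-! ### The exact modulus of the return amplitude off the promise -/

/-- **Exact modulus off the promise.** For `k = 2`, `n` even and at most one idle wire the return
amplitude of the landed signed family has modulus EXACTLY `(1 + Φ(I))/2` (no `|Φ| ≥ 3/5` needed; the
landed `SgnForrMem.norm_phiFin_of_promise` is the special case on the promise, with `ρ` hidden).
[cite: AaronsonAmbainis2018, §3.2 Prop. 6] -/
theorem norm_phiFin_of_le (I : KForrelationInstance) (hk : I.k = 2) (he : Even I.n)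
    (h : I.n ≤ sR I + 1) (A : Language Bool) :
    ‖phiFin paramsS specS I.encode A fun _ => false‖ = (1 + I.value) / 2 := by
  obtain ⟨hq, hq0⟩ := isSelfDualBent_qM (even_WdS_of_le I h)
  have e : forrelation (fun w : Fin (WdS I) → Bool => cfun I 0 w) (fun w => cfun I 1 w) = I.value := by
    rw [forrelation_cfun I hk (WdS I) (sR_le_WdS I), value_eq, hk, WdS_eq_of_le I h, if_pos he,
      Nat.add_zero]
  rw [phiFin_encode I hk, gS_vec, Complex.norm_real, Real.norm_eq_abs]
  have hg := kForrelationValue_gadget (fun w : Fin (WdS I) → Bool => cfun I 0 w) (fun w => cfun I 1 w)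
    (qW I) hq hq0
  simp only at hg
  rw [show (qW I) = fun w => qW I w from rfl] at hg
  erw [hg, abs_gadget, e]

/-- Hence the EXACT acceptance probability off the promise: `1 − (1 − ((1+Φ)/2)²)³`.
[cite: AaronsonAmbainis2018, §3.2 Prop. 6] -/
theorem acceptProbOn_of_le (I : KForrelationInstance) (hk : I.k = 2) (he : Even I.n)
    (h : I.n ≤ sR I + 1) :
    (family paramsS).acceptProbOn 0 I.encode = 1 - (1 - ((1 + I.value) / 2) ^ 2) ^ 3 := by
  rw [acceptProbOn_family paramsS specS I.encode 0, norm_phiFin_of_le I hk he h]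

/-! ### The witness `(2, 2, x₀ ∧ x₁, C')` for any `B₂`-circuit `C'` computing `x₀ ∧ ¬x₁` -/

/-- `Φ(x₀x₁, x₀(1+x₁)) = 0`: `x₀x₁` is self-dual bent and `x₀x₁ ⊕ x₀(1+x₁) = x₀` is balanced.
[cite: AaronsonAmbainis2018, §1.1.1] -/
theorem forrelation_and_andNot :
    forrelation (fun x : Fin 2 → Bool => x 0 && x 1) (fun x => x 0 && !x 1) = 0 := by
  unfold forrelation
  simp only [← (piFinTwoEquiv fun _ : Fin 2 => Bool).symm.sum_comp, Fintype.sum_prod_type,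
    Fintype.sum_bool, twist, Fin.prod_univ_two, signOf]
  simp [piFinTwoEquiv]

/-- `x₀ ∧ ¬x₁ = [x₀(1 + x₁) = 1]` has algebraic degree `≤ 2 ≤ 3`. [cite: Carlet2020, §2.2.1 Def. 6] -/
theorem isDegLeFun_andNot : IsDegLeFun 3 (fun x : Fin 2 → Bool => x 0 && !x 1) := by
  refine ⟨MvPolynomial.X 0 * (1 + MvPolynomial.X 1), ?_, fun x => ?_⟩
  · calc (MvPolynomial.X 0 * (1 + MvPolynomial.X 1) : MvPolynomial (Fin 2) (ZMod 2)).totalDegree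
          ≤ (MvPolynomial.X 0 : MvPolynomial (Fin 2) (ZMod 2)).totalDegree +
            (1 + MvPolynomial.X 1 : MvPolynomial (Fin 2) (ZMod 2)).totalDegree :=
            MvPolynomial.totalDegree_mul _ _
      _ ≤ 1 + 1 := by
            refine add_le_add (MvPolynomial.totalDegree_X (R := ZMod 2) _).le ?_
            refine (MvPolynomial.totalDegree_add _ _).trans (max_le ?_ ?_)
            · simp
            · exact (MvPolynomial.totalDegree_X (R := ZMod 2) _).le
      _ ≤ 3 := by norm_num
  · simp only [polyPhase, map_mul, map_add, map_one, MvPolynomial.eval_X]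
    cases x 0 <;> cases x 1 <;> decide

/-- **The witness, abstractly**: for ANY `B₂`-circuit `C'` on two inputs computing `x₀ ∧ ¬x₁` and reading
wire `0`, the instance `(2, 2, x₀ ∧ x₁, C')` is well-formed cubic with `Φ = 0` and the landed signed
family accepts its code with probability EXACTLY `37/64`. [cite: AaronsonAmbainis2018, §3.2 Prop. 6] -/
theorem ungapped_of (C' : Circuit (Fin 2)) (hC' : ∀ x, C'.eval x = (x 0 && !x 1)) (hover : C'.IsOver B2)
    (hreads : (0 : ℕ) ∈ occList ⟨2, 2, ![andTwoCircuit, C']⟩) :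
    (⟨2, 2, ![andTwoCircuit, C']⟩ : KForrelationInstance).IsOverB2 ∧
    (⟨2, 2, ![andTwoCircuit, C']⟩ : KForrelationInstance).k = 2 ∧
    Even (⟨2, 2, ![andTwoCircuit, C']⟩ : KForrelationInstance).n ∧
    (∀ i, IsDegLeFun 3 ((⟨2, 2, ![andTwoCircuit, C']⟩ : KForrelationInstance).C i).eval) ∧
    (⟨2, 2, ![andTwoCircuit, C']⟩ : KForrelationInstance).n ≤ sR ⟨2, 2, ![andTwoCircuit, C']⟩ + 1 ∧
    (⟨2, 2, ![andTwoCircuit, C']⟩ : KForrelationInstance).value = 0 ∧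
    (family paramsS).acceptProbOn 0 (KForrelationInstance.encode ⟨2, 2, ![andTwoCircuit, C']⟩) = 37 / 64 := by
  set I : KForrelationInstance := ⟨2, 2, ![andTwoCircuit, C']⟩ with hI
  have hC'f : C'.eval = fun x => x 0 && !x 1 := funext hC'
  have hB2 : I.IsOverB2 := by
    intro i
    fin_cases i
    · exact andTwoCircuit_isOver
    · exact hover
  have hdeg : ∀ i, IsDegLeFun 3 (I.C i).eval := by
    intro i
    fin_cases i
    · exact isDegLeFun_andTwoCircuit_eval
    · show IsDegLeFun 3 C'.eval
      rw [hC'f]; exact isDegLeFun_andNot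
  have hle : I.n ≤ sR I + 1 := by
    have h1 : (Rl I).map bitsToNat ≠ [] := List.ne_nil_of_mem ((mem_Rl_values_iff I 0).2 hreads)
    have h2 : 1 ≤ sR I := by
      rw [Nat.one_le_iff_ne_zero]
      intro h
      apply h1
      rw [List.map_eq_nil_iff, ← List.length_eq_zero_iff]
      exact h
    show 2 ≤ sR I + 1
    omega
  have hval : I.value = 0 := by
    rw [hI, KForrelationInstance.value_mk_two]
    simp only [Matrix.cons_val_zero, Matrix.cons_val_one]
    rw [hC'f, show andTwoCircuit.eval = fun x : Fin 2 → Bool => x 0 && x 1 from funext andTwoCircuit_eval]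
    exact forrelation_and_andNot
  refine ⟨hB2, rfl, (show Even 2 from even_two), hdeg, hle, hval, ?_⟩
  rw [acceptProbOn_of_le I rfl (show Even 2 from even_two) hle, hval]
  norm_num

/-! ### The witness, concretely -/

/-- **A well-formed cubic code on which the landed signed family is ungapped**: `B₂`-circuits, `k = 2`,
`n = 2` even, degree `≤ 3`, every wire read (`n ≤ #R + 1`), `Φ = 0`, acceptance EXACTLY `37/64`.
The second circuit is the one-gate circuit `x₀ ∧ ¬x₁`. [cite: AaronsonAmbainis2018, §3.2 Prop. 6] -/
theorem exists_wf_cubic_code_ungapped :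
    ∃ I : KForrelationInstance, I.IsOverB2 ∧ I.k = 2 ∧ Even I.n ∧ (∀ i, IsDegLeFun 3 (I.C i).eval) ∧
      I.n ≤ sR I + 1 ∧ I.value = 0 ∧ (family paramsS).acceptProbOn 0 I.encode = 37 / 64 :=
  ⟨_, ungapped_of
    { gates := [⟨2, fun v => v 0 && !v 1, fun a => .inl a⟩]
      output := .inr 0
      wf := fun j h a m hm => by
        simp only [List.length_singleton, Nat.lt_one_iff] at h
        subst h
        simp at hm
      wf_output := fun m h => by cases h; simp }
    (fun _ => rfl)
    (by intro g hg; simp only [List.mem_singleton] at hg; subst hg; exact le_refl 2)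
    (by decide)⟩

/-! ### Consequences -/

/-- **The landed family is not a `BQP` decider of ANY language**: it has an input accepted with
probability strictly between `1/3` and `2/3`. In particular K2's separating language cannot be
witnessed by `PhaseQuery.family SgnForrMem.paramsS` itself — amplification (stub A of the picked line)
or another family is load-bearing. [cite: AaronsonAmbainis2018, §3.2 Prop. 6] -/
theorem landedFamily_not_bqp_decider :
    ¬ ∃ L : Language Bool, ∀ x, (x ∈ L → (2 : ℝ) / 3 ≤ (family paramsS).acceptProbOn 0 x) ∧
      (x ∉ L → (family paramsS).acceptProbOn 0 x ≤ 1 / 3) := by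
  rintro ⟨L, hL⟩
  obtain ⟨I, -, -, -, -, -, -, hacc⟩ := exists_wf_cubic_code_ungapped
  obtain ⟨hy, hn⟩ := hL I.encode
  by_cases hx : I.encode ∈ L
  · have := hy hx; rw [hacc] at this; norm_num at this
  · have := hn hx; rw [hacc] at this; norm_num at this

/-- Hence the landed family witnesses NO membership `L ∈ BQP` (as the family of `BQPWith cliffordT (1/3)`).
[cite: BernsteinVazirani1997, Def. 8] -/
theorem landedFamily_not_bqp_witness (L : Language Bool) :
    ¬ ∀ x, (x ∈ L → 1 - (1 : ℝ) / 3 ≤ (family paramsS).acceptProbOn 0 x) ∧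
      (x ∉ L → (family paramsS).acceptProbOn 0 x ≤ 1 / 3) := by
  intro h
  refine landedFamily_not_bqp_decider ⟨L, fun x => ⟨fun hx => ?_, fun hx => (h x).2 hx⟩⟩
  have := (h x).1 hx
  linarith

/-- **The `K = 1` shortcut of stub V is false** (no isolation hypothesis involved): it is NOT the case
that the landed family rejects every well-formed cubic code with `Φ ≠ 1` with probability `≤ 1/3`.
`NearExactIsExact` bounds such acceptances away from `1` only; the AND-power stub A (or an equivalent
error reduction at the TOP of `[0,1]`) is load-bearing in the line. [cite: AaronsonAmbainis2018, §3.2 Prop. 6] -/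
theorem not_noSide_le_third :
    ¬ ∀ I : KForrelationInstance, I.IsOverB2 → I.k = 2 → Even I.n → (∀ i, IsDegLeFun 3 (I.C i).eval) →
      I.n ≤ sR I + 1 → I.value ≠ 1 → (family paramsS).acceptProbOn 0 I.encode ≤ 1 / 3 := by
  intro h
  obtain ⟨I, h1, h2, h3, h4, h5, h6, hacc⟩ := exists_wf_cubic_code_ungapped
  have := h I h1 h2 h3 h4 h5 (by rw [h6]; norm_num)
  rw [hacc] at this
  norm_num at this

/-- Dually, the no-side value `37/64` is not `≥ 2/3` either: on well-formed cubic codes the acceptance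
of the landed family is NOT confined to `[0, 1/3] ∪ [2/3, 1]` — the value set of `Φ` on cubic pairs
meets the window `(2·√(1−∛(2/3)) − 1, 2·√(1−∛(1/3)) − 1) ∋ 0`. [cite: AaronsonAmbainis2018, §3.2 Prop. 6] -/
theorem exists_wf_cubic_code_accept_mem_Ioo :
    ∃ I : KForrelationInstance, I.IsOverB2 ∧ I.k = 2 ∧ Even I.n ∧ (∀ i, IsDegLeFun 3 (I.C i).eval) ∧
      I.n ≤ sR I + 1 ∧ (family paramsS).acceptProbOn 0 I.encode ∈ Set.Ioo ((1 : ℝ) / 3) (2 / 3) := by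
  obtain ⟨I, h1, h2, h3, h4, h5, -, hacc⟩ := exists_wf_cubic_code_ungapped
  exact ⟨I, h1, h2, h3, h4, h5, by rw [hacc]; constructor <;> norm_num⟩

end Summit.QuantumAdvantage.QuantumAdvantage.Theorems.SignedExactSliceIsLift.Negative

end
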